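import Literature.NumberTheory.LFunctions.ZetaZeroTailSums
import Summits.RiemannHypothesis.RiemannHypothesis.Theorems.EtaLeadingQuarterEtaLeadingSecondMomentOddSquares

/-!
# The diagonal of the dual main term: `2M ∑_{odd ν} ν⁻¹ ∑_{|γ|>πMν−1} m/γ² ≤ (1+1/M)(log M+1)/4 + C`
(route EtaLeadingQuarter, item `EtaLeadingSecondMoment`, stmt-RiemannHypothesis-21791; BRIEF-L18-K1 §1)

RH-free bookkeeping for regime (Z3): the zero-density input is the tree's explicit tail bound
`ZetaZeroTails.tailInvImSq_le` (`∑_{|γ|>T} m/γ² ≤ 2G(T)`, Schoenfeld's `G`) whose LEADING term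
`(log(T/2π)+1)/(πT)` carries the constant; with `T = πMν − 1` and `∑_{odd} 1/ν² ≤ π²/8`
(`EtaTrial.sum_odd_inv_sq_le`) the diagonal is `≤ (1 + 1/M)(log M + 1)/4 + 80`.
Nothing here bears on the truth of RH.
-/

noncomputable section

open Finset
open scoped Real

set_option linter.dupNamespace false  -- the mandated namespace repeats `RiemannHypothesis`

namespace Summit.RiemannHypothesis.RiemannHypothesis.Theorems.EtaLeadingQuarter.EtaTrial

open Literature.NumberTheory.LFunctions NicolasJExplicit SchoenfeldBound ZetaZeroTails

/-- The tail of `∑ m/γ²` with Schoenfeld's `G` unfolded: for `T ≥ 2516`,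
`∑_{|γ|>T} m/γ² ≤ (log(T/2π) + 1)/(πT) + (146 + 27 log T)/T²`. [folklore] -/
theorem tailInvImSq_le_leading {T : ℝ} (hT : 2516 ≤ T) :
    tailInvImSq T ≤ (Real.log (T / (2 * π)) + 1) / (π * T) + (146 + 27 * Real.log T) / T ^ 2 := by
  have h := tailInvImSq_le hT
  have hT0 : 0 < T := by linarith
  have hπ := Real.pi_gt_three
  have hlogT : 0 ≤ Real.log T := Real.log_nonneg (by linarith)
  have hG : 2 * Gtail T ≤ (Real.log (T / (2 * π)) + 1) / (π * T) + (146 + 27 * Real.log T) / T ^ 2 := by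
    rw [Gtail]
    have e1 : 2 * ((Real.log (T / (2 * π)) + 1) / (2 * π) * T⁻¹) = (Real.log (T / (2 * π)) + 1) / (π * T) := by
      field_simp
    have e2 : 2 * ((2 * 34.6 + 6.67 / 2 + 2 * 6.67 * Real.log T) * (T ^ 2)⁻¹) =
        (145.07 + 26.68 * Real.log T) / T ^ 2 := by
      rw [div_eq_mul_inv]; ring
    have e3 : 2 * (5 * 0.3725 / 3 * (T ^ 3)⁻¹) ≤ 0.5 / T ^ 2 := by
      have e : 2 * (5 * 0.3725 / 3 * (T ^ 3)⁻¹) = (2 * (5 * 0.3725 / 3) / T) / T ^ 2 := by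
        rw [div_div, div_eq_mul_inv, div_eq_mul_inv]; ring
      rw [e]
      apply div_le_div_of_nonneg_right _ (by positivity)
      rw [div_le_iff₀ hT0]; nlinarith
    have e4 : (145.07 + 26.68 * Real.log T) / T ^ 2 + 0.5 / T ^ 2 ≤ (146 + 27 * Real.log T) / T ^ 2 := by
      rw [← add_div]; apply div_le_div_of_nonneg_right _ (by positivity); nlinarith
    nlinarith [e1, e2, e3, e4]
  exact h.trans hG

/-- Telescoping majorant: for `ν ≥ 2`, `1/(ν√ν) ≤ 2/√(ν−1) − 2/√ν`. [folklore] -/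
theorem inv_mul_sqrt_le_telescope {ν : ℝ} (hν : 2 ≤ ν) :
    1 / (ν * Real.sqrt ν) ≤ 2 / Real.sqrt (ν - 1) - 2 / Real.sqrt ν := by
  have h0 : 0 < ν := by linarith
  have h1 : 0 < ν - 1 := by linarith
  set a := Real.sqrt ν with ha_def
  set b := Real.sqrt (ν - 1) with hb_def
  have ha : 0 < a := Real.sqrt_pos.2 h0
  have hb : 0 < b := Real.sqrt_pos.2 h1
  have haa : a * a = ν := Real.mul_self_sqrt h0.le
  have hbb : b * b = ν - 1 := Real.mul_self_sqrt h1.le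
  have hle : b ≤ a := Real.sqrt_le_sqrt (by linarith)
  have hprod : (a - b) * (a + b) = 1 := by nlinarith
  have e : 2 / b - 2 / a = 2 * (a - b) / (b * a) := by field_simp
  rw [e, div_le_div_iff₀ (by positivity) (by positivity), one_mul, ← haa]
  have key : 2 * (a - b) * (a * a * a) - b * a =
      a * (a - b) ^ 2 * (2 * a + b) + a * b * ((a - b) * (a + b)) - a * b := by ring
  rw [hprod] at key
  nlinarith [mul_nonneg (mul_nonneg ha.le (sq_nonneg (a - b))) (by positivity : (0 : ℝ) ≤ 2 * a + b)]

/-- `∑_{ν=1}^{W} 1/(ν√ν) ≤ 3 − 2/√W` for `W ≥ 1`. [folklore] -/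
theorem sum_inv_mul_sqrt_le_aux (W : ℕ) (hW : 1 ≤ W) :
    ∑ ν ∈ Finset.Icc 1 W, (1 : ℝ) / (ν * Real.sqrt ν) ≤ 3 - 2 / Real.sqrt W := by
  induction W with
  | zero => omega
  | succ W ih =>
    rcases Nat.eq_zero_or_pos W with h0 | hWpos
    · subst h0; simp; norm_num
    rw [Finset.sum_Icc_succ_top (by omega)]
    have h1 := ih hWpos
    have hW1 : (1 : ℝ) ≤ W := by exact_mod_cast hWpos
    have hW2 : (2 : ℝ) ≤ ((W + 1 : ℕ) : ℝ) := by push_cast; linarith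
    have h2 := inv_mul_sqrt_le_telescope hW2
    have e : ((W + 1 : ℕ) : ℝ) - 1 = W := by push_cast; ring
    rw [e] at h2
    linarith

/-- `∑_{ν=1}^{V} 1/(ν√ν) ≤ 3`. [folklore] -/
theorem sum_inv_mul_sqrt_le (V : ℕ) : ∑ ν ∈ Finset.Icc 1 V, (1 : ℝ) / (ν * Real.sqrt ν) ≤ 3 := by
  rcases Nat.eq_zero_or_pos V with h0 | hpos
  · subst h0; simp
  have h := sum_inv_mul_sqrt_le_aux V hpos
  have : 0 ≤ 2 / Real.sqrt (V : ℝ) := by positivity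
  linarith

/-- `∑_{odd ν ≤ V} log ν/ν² ≤ 6` (`log ν ≤ 2√ν`). [folklore] -/
theorem sum_odd_log_div_sq_le (V : ℕ) :
    ∑ ν ∈ (Finset.Icc 1 V).filter (fun ν ↦ ¬Even ν), Real.log ν / (ν : ℝ) ^ 2 ≤ 6 := by
  have hsub : ∑ ν ∈ (Finset.Icc 1 V).filter (fun ν ↦ ¬Even ν), Real.log ν / (ν : ℝ) ^ 2 ≤
      ∑ ν ∈ Finset.Icc 1 V, Real.log ν / (ν : ℝ) ^ 2 :=
    Finset.sum_le_sum_of_subset_of_nonneg (Finset.filter_subset _ _) fun ν hν _ ↦ by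
      have : (1 : ℝ) ≤ ν := by exact_mod_cast (Finset.mem_Icc.1 hν).1
      exact div_nonneg (Real.log_nonneg this) (sq_nonneg _)
  refine hsub.trans ?_
  have hterm : ∀ ν ∈ Finset.Icc 1 V, Real.log ν / (ν : ℝ) ^ 2 ≤ 2 * (1 / (ν * Real.sqrt ν)) := by
    intro ν hν
    have hν1 : (1 : ℝ) ≤ ν := by exact_mod_cast (Finset.mem_Icc.1 hν).1
    have hν0 : (0 : ℝ) < ν := by linarith
    have hlog : Real.log ν ≤ 2 * Real.sqrt ν := by
      have h := Real.log_le_rpow_div hν0.le (by norm_num : (0 : ℝ) < 1 / 2)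
      rw [← Real.sqrt_eq_rpow] at h
      linarith
    have hs : 0 < Real.sqrt ν := Real.sqrt_pos.2 hν0
    have hss : Real.sqrt ν * Real.sqrt ν = ν := Real.mul_self_sqrt hν0.le
    rw [div_le_iff₀ (by positivity)]
    have e : 2 * (1 / (ν * Real.sqrt ν)) * (ν : ℝ) ^ 2 = 2 * ν / Real.sqrt ν := by
      field_simp
    rw [e, le_div_iff₀ hs]
    nlinarith
  calc ∑ ν ∈ Finset.Icc 1 V, Real.log ν / (ν : ℝ) ^ 2 ≤ ∑ ν ∈ Finset.Icc 1 V, 2 * (1 / (ν * Real.sqrt ν)) :=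
        Finset.sum_le_sum hterm
    _ = 2 * ∑ ν ∈ Finset.Icc 1 V, 1 / (ν * Real.sqrt ν) := by rw [Finset.mul_sum]
    _ ≤ 6 := by linarith [sum_inv_mul_sqrt_le V]

end Summit.RiemannHypothesis.RiemannHypothesis.Theorems.EtaLeadingQuarter.EtaTrial

end
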